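import Summits.CriticalPhenomena.PercolationContinuityZ3.Theorems.PercNearOneGluingNoHeavyLowerTailFrontierDecRowsClusterMarkov
import Summits.CriticalPhenomena.PercolationContinuityZ3.Theorems.PercNearOneGluingNoHeavyLowerTailFrontierDecRowsLiteralDropping
import Summits.CriticalPhenomena.PercolationContinuityZ3.Theorems.PercNearOneGluingNoHeavyLowerTailE3FourPointClassesAllGraphs
import Literature.Probability.Percolation.TwoSetExchange
import HarnessLib

/-!
# The four-point dec cubic frontier and a TYPED THIRD-ORDER BHK inequality: rows 36 (PATH), 44 and 15 — hence also 12, 27, 30 — are instances of ONE statement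

Support file (prover prim-ineq-prove-3 gen 10; `--supports stmt-CriticalPhenomena-4575`).  No definitions, no named facts, no sorries, no `native_decide`.
Everything here is CONDITIONAL on the hypothesis `hG` below (written out in each theorem; it is NOT a tree fact and NOT claimed): the file records which open rows it would settle.

The hypothesis (conjecture "G", typed third-order BHK; prim-ineq-prove-3 gen 10, memo FINDING-HYBRID-gen10.md §10).  For disjoint terminal sets `S, T`, the separation event
`D = {S ↮ T}`, an event `A` of BHK type `(+)` (closed under enlarging the open cluster of `S` and shrinking that of `T`) and an event `B` of type `(−)`:
  `0 ≤ E₃(D, Aᶜ, Bᶜ)`.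
Van den Berg–Häggström–Kahn's two-set exchange (tree `setTwoClusterExchange`, BHK 2006 Thm 2.1) is the SECOND-order statement `μ(D∩A∩B)μ(D) ≤ μ(D∩A)μ(D∩B)`; in the
conditional-Harris decomposition `E₃(D, Aᶜ, Bᶜ) = μ(D)·[Cov_D(Aᶜ,Bᶜ) + (μ(Aᶜ|D) − μ(Aᶜ))(μ(Bᶜ|D) − μ(Bᶜ))] + Cov(1_{Aᶜ∩Bᶜ}, 1_D)` it fixes the sign of the first term
(≤ 0), so `G` says: BHK's negative-correlation deficit given `D` is at most the product of the two Harris boosts plus `Cov(AᶜBᶜ, D)`.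
EVIDENCE (not a proof): exact laws of random weighted graphs `n ≤ 7` and structured families (K_n, cycles, stars, two-hub graphs), `A, B` ranging over all monotone
Boolean combinations of ≤ 3 typed connection literals on four terminals: 59 722 typed cases × 100 laws and 10 834 cases × 520 laws, 0 violations (lab/g_probe*.py).
INSTANCES among the 45 essential orbits: the theorems 3PT-LB (row 43), row 33 (free-vertex split), … and SIX of the seven open rows: 36 = `E₃({a↮b}, {a↮c}, {b↮y})`
(`S={a}, T={b}, A={a~c}, B={b~y}`), 44 = `E₃(D[ab|cy], {a↮b}, {c↮y})` (`S={a,b}, T={c,y}`, internal literals), 15 = `E₃(D[ab|c], D[ac|y], D[b|y])`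
(`S={y}, T={a,c}, A={y~b}, B={c~a}∪{c~b}`), and 12, 27, 30 through `…FrontierDecRowsLiteralDropping` (they follow from 44).  Row 37 `(D[ab|c], D[ac|y], D[ay|b])` is NOT
an instance (every choice of middle leaves mixed-type events).

* `frontier_36_of_typedBHK3`, `frontier_44_of_typedBHK3`, `frontier_15_of_typedBHK3` — the three reductions (same `n`, same `w`).
-/

noncomputable section

namespace Summit.CriticalPhenomena.PercolationContinuityZ3.Theorems.FrontierDecRows

open MeasureTheory CovTransferCert E3GroupSepCert
open Literature.Probability.Percolation Literature.Probability.LatticeModels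
open Literature.Probability.Percolation.TwoSetExchange

variable {n : ℕ}

/-! ### Small dictionary: separation events of one or two literals -/

/-- `openConn` membership is symmetric. [folklore] -/
theorem mem_openConn_comm {u v : Fin n} {ω : BondConfig (Fin n)} : ω ∈ openConn u v ↔ ω ∈ openConn v u :=
  ⟨fun h => SimpleGraph.Reachable.symm h, fun h => SimpleGraph.Reachable.symm h⟩

/-- `D[uu'|v] = ({v ~ u} ∪ {v ~ u'})ᶜ`. [this work] -/
theorem connEvent_sep_pair_single (u u' v : Fin n) :
    connEvent (sep [u, u'] [v]) = (openConn v u ∪ openConn v u')ᶜ := by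
  ext ω
  simp only [mem_connEvent_sep, List.mem_cons, List.not_mem_nil, or_false, forall_eq_or_imp, forall_eq, Set.mem_compl_iff,
    Set.mem_union, not_or]
  rw [mem_openConn_comm (u := u) (v := v), mem_openConn_comm (u := u') (v := v)]

/-- The separation event in BHK's set-builder form. [this work] -/
theorem connEvent_sep_eq_D (X Y : List (Fin n)) :
    connEvent (sep X Y) = {ω : BondConfig (Fin n) | ∀ s ∈ ({v | v ∈ X} : Set (Fin n)), ∀ t ∈ ({v | v ∈ Y} : Set (Fin n)),
      ¬ (openGraph ω).Reachable s t} :=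
  connEvent_sep_eq_setOf X Y

/-! ### The three reductions -/

variable (w : Sym2 (Fin n) → unitInterval)

/-- **PATH (row 36) from the typed third-order BHK inequality** (`S = {a}`, `T = {b}`, `A = {a ~ c}`, `B = {b ~ y}`). [this work] -/
theorem frontier_36_of_typedBHK3
    (hG : ∀ (S T : Set (Fin n)) (A B : Set (BondConfig (Fin n))),
      (∀ ⦃ω ω' : BondConfig (Fin n)⦄, (⋃ s ∈ S, openEdgeCluster ω s) ⊆ (⋃ s ∈ S, openEdgeCluster ω' s) →
        (⋃ t ∈ T, openEdgeCluster ω' t) ⊆ (⋃ t ∈ T, openEdgeCluster ω t) → ω ∈ A → ω' ∈ A) →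
      (∀ ⦃ω ω' : BondConfig (Fin n)⦄, (⋃ s ∈ S, openEdgeCluster ω' s) ⊆ (⋃ s ∈ S, openEdgeCluster ω s) →
        (⋃ t ∈ T, openEdgeCluster ω t) ⊆ (⋃ t ∈ T, openEdgeCluster ω' t) → ω ∈ B → ω' ∈ B) →
      0 ≤ sahiE3 (prodBernoulli w) {ω : BondConfig (Fin n) | ∀ s ∈ S, ∀ t ∈ T, ¬ (openGraph ω).Reachable s t} Aᶜ Bᶜ)
    (a b c y : Fin n) :
    0 ≤ sahiE3 (prodBernoulli w) (connEvent (row 36 n (a, b, c, y)).1) (connEvent (row 36 n (a, b, c, y)).2.1)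
      (connEvent (row 36 n (a, b, c, y)).2.2) := by
  have hr : row 36 n (a, b, c, y) = (sep [a] [b], sep [a] [c], sep [b] [y]) := rfl
  rw [hr]
  dsimp only
  rw [connEvent_sep_eq_D [a] [b], connEvent_sep_one_one a c, connEvent_sep_one_one b y]
  refine hG {v | v ∈ [a]} {v | v ∈ [b]} (openConn a c) (openConn b y) ?_ ?_
  · intro ω ω' hs ht hω
    exact typePlus_openConn_of_mem {v | v ∈ [a]} {v | v ∈ [b]} (by simp) c hs ht hω
  · intro ω ω' hs ht hω
    exact typeMinus_openConn_of_mem {v | v ∈ [a]} {v | v ∈ [b]} (by simp) y hs ht hω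

/-- **Row 44 `(D[ab|cy], D[a|b], D[c|y])` from the typed third-order BHK inequality** (`S = {a,b}`, `T = {c,y}`, `A = {a ~ b}`, `B = {c ~ y}`). [this work] -/
theorem frontier_44_of_typedBHK3
    (hG : ∀ (S T : Set (Fin n)) (A B : Set (BondConfig (Fin n))),
      (∀ ⦃ω ω' : BondConfig (Fin n)⦄, (⋃ s ∈ S, openEdgeCluster ω s) ⊆ (⋃ s ∈ S, openEdgeCluster ω' s) →
        (⋃ t ∈ T, openEdgeCluster ω' t) ⊆ (⋃ t ∈ T, openEdgeCluster ω t) → ω ∈ A → ω' ∈ A) →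
      (∀ ⦃ω ω' : BondConfig (Fin n)⦄, (⋃ s ∈ S, openEdgeCluster ω' s) ⊆ (⋃ s ∈ S, openEdgeCluster ω s) →
        (⋃ t ∈ T, openEdgeCluster ω t) ⊆ (⋃ t ∈ T, openEdgeCluster ω' t) → ω ∈ B → ω' ∈ B) →
      0 ≤ sahiE3 (prodBernoulli w) {ω : BondConfig (Fin n) | ∀ s ∈ S, ∀ t ∈ T, ¬ (openGraph ω).Reachable s t} Aᶜ Bᶜ)
    (a b c y : Fin n) :
    0 ≤ sahiE3 (prodBernoulli w) (connEvent (row 44 n (a, b, c, y)).1) (connEvent (row 44 n (a, b, c, y)).2.1)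
      (connEvent (row 44 n (a, b, c, y)).2.2) := by
  have hr : row 44 n (a, b, c, y) = (sep [a, b] [c, y], sep [a] [b], sep [c] [y]) := rfl
  rw [hr]
  dsimp only
  rw [connEvent_sep_eq_D [a, b] [c, y], connEvent_sep_one_one a b, connEvent_sep_one_one c y]
  refine hG {v | v ∈ [a, b]} {v | v ∈ [c, y]} (openConn a b) (openConn c y) ?_ ?_
  · intro ω ω' hs ht hω
    exact typePlus_openConn_of_mem {v | v ∈ [a, b]} {v | v ∈ [c, y]} (by simp) b hs ht hω
  · intro ω ω' hs ht hω
    exact typeMinus_openConn_of_mem {v | v ∈ [a, b]} {v | v ∈ [c, y]} (by simp) y hs ht hω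

/-- **Row 15 `(D[ab|c], D[ac|y], D[b|y])` from the typed third-order BHK inequality** (`S = {y}`, `T = {a,c}`, `A = {y ~ b}`, `B = {c ~ a} ∪ {c ~ b}`;
middle `D[ac|y]`). [this work] -/
theorem frontier_15_of_typedBHK3
    (hG : ∀ (S T : Set (Fin n)) (A B : Set (BondConfig (Fin n))),
      (∀ ⦃ω ω' : BondConfig (Fin n)⦄, (⋃ s ∈ S, openEdgeCluster ω s) ⊆ (⋃ s ∈ S, openEdgeCluster ω' s) →
        (⋃ t ∈ T, openEdgeCluster ω' t) ⊆ (⋃ t ∈ T, openEdgeCluster ω t) → ω ∈ A → ω' ∈ A) →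
      (∀ ⦃ω ω' : BondConfig (Fin n)⦄, (⋃ s ∈ S, openEdgeCluster ω' s) ⊆ (⋃ s ∈ S, openEdgeCluster ω s) →
        (⋃ t ∈ T, openEdgeCluster ω t) ⊆ (⋃ t ∈ T, openEdgeCluster ω' t) → ω ∈ B → ω' ∈ B) →
      0 ≤ sahiE3 (prodBernoulli w) {ω : BondConfig (Fin n) | ∀ s ∈ S, ∀ t ∈ T, ¬ (openGraph ω).Reachable s t} Aᶜ Bᶜ)
    (a b c y : Fin n) :
    0 ≤ sahiE3 (prodBernoulli w) (connEvent (row 15 n (a, b, c, y)).1) (connEvent (row 15 n (a, b, c, y)).2.1)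
      (connEvent (row 15 n (a, b, c, y)).2.2) := by
  have hr : row 15 n (a, b, c, y) = (sep [a, b] [c], sep [a, c] [y], sep [b] [y]) := rfl
  rw [hr]
  dsimp only
  -- reorder to (middle, D[b|y], D[ab|c]) = (D, Aᶜ, Bᶜ)
  rw [sahiE3_comm₁₂ (prodBernoulli w) (connEvent (sep [a, b] [c])), sahiE3_comm₂₃ (prodBernoulli w) (connEvent (sep [a, c] [y]))]
  rw [connEvent_sep_comm [a, c] [y], connEvent_sep_eq_D [y] [a, c], connEvent_sep_one_one b y, connEvent_sep_pair_single a b c]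
  have hby : (openConn b y : Set (BondConfig (Fin n)))ᶜ = (openConn y b)ᶜ := by
    ext ω; simp only [Set.mem_compl_iff]; rw [mem_openConn_comm]
  rw [hby]
  refine hG {v | v ∈ [y]} {v | v ∈ [a, c]} (openConn y b) (openConn c a ∪ openConn c b) ?_ ?_
  · intro ω ω' hs ht hω
    exact typePlus_openConn_of_mem {v | v ∈ [y]} {v | v ∈ [a, c]} (by simp) b hs ht hω
  · intro ω ω' hs ht hω
    rcases hω with h | h
    · exact Or.inl (typeMinus_openConn_of_mem {v | v ∈ [y]} {v | v ∈ [a, c]} (by simp) a hs ht h)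
    · exact Or.inr (typeMinus_openConn_of_mem {v | v ∈ [y]} {v | v ∈ [a, c]} (by simp) b hs ht h)

/-! ### Erratum (gen 10, cycle 1) and the CORRECTED typing: cluster-monotone events

The hypothesis `hG` of the three theorems above quantifies over BHK type-`(±)` events, i.e. events closed under (enlarging `C_S`, shrinking
`C_T`).  That class is TOO LARGE for a third-order statement and the hypothesis is refutable, so the three theorems above are VACUOUS:
take `S = {a}`, `T = {b}` on a triangle `a, b, y` with edge weights in `(0,1)`, `A = {b ↮ y}` (type `(+)`: it only needs `C_T` to shrink) and
`B = ∅` (type `(−)`); then `E₃(D, Aᶜ, univ) = Cov(1_D, 1_{b~y}) < 0`.  The statement that the evidence of memo §10 supports (and that the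
probes actually tested) is the CLUSTER-MONOTONE one: `A` is an increasing function of the open edge cluster `C_S = ⋃_{s∈S} C_s` ALONE and `B`
an increasing function of `C_T` alone.  The theorems below restate the three reductions with that hypothesis (`hG'`); the instances only use
connection literals `{s ~ v}`, `s ∈ S` (resp. `{t ~ v}`, `t ∈ T`), which are cluster-monotone by `typePlus_openConn_of_mem _ ∅`.
Additional evidence for the general cluster-monotone class (random threshold / required-edge / vertex-count functions of `C_S`, `C_T` and their
∧/∨-combinations, exact laws `n ≤ 6`): lab/g_probe_gen.py (gen 10 cycle 1). -/

/-- Connection to a source is CLUSTER-MONOTONE: for `s₀ ∈ S`, `C_S(ω) ⊆ C_S(ω') → ω ∈ {s₀ ~ v} → ω' ∈ {s₀ ~ v}`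
(the type-`(+)` lemma with `T = ∅`). [folklore; cite: VandenbergHaggstromKahn2005, Remark 1 after Thm. 1.2 (p. 5)] -/
theorem clusterMono_openConn_of_mem (S : Set (Fin n)) {s₀ : Fin n} (hs₀ : s₀ ∈ S) (v : Fin n)
    ⦃ω ω' : BondConfig (Fin n)⦄ (hs : (⋃ s ∈ S, openEdgeCluster ω s) ⊆ (⋃ s ∈ S, openEdgeCluster ω' s))
    (h : ω ∈ (openConn s₀ v : Set (BondConfig (Fin n)))) : ω' ∈ (openConn s₀ v : Set (BondConfig (Fin n))) :=
  typePlus_openConn_of_mem S (∅ : Set (Fin n)) hs₀ v hs (by simp) h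

/-- **Row 36 (PATH) from the cluster-monotone third-order BHK inequality `G`** (`S = {a}`, `T = {b}`, `A = {a ~ c}`, `B = {b ~ y}`):
if `0 ≤ E₃({S ↮ T}, Aᶜ, Bᶜ)` for all cluster-monotone `A` (w.r.t. `C_S`) and `B` (w.r.t. `C_T`), then row 36 holds. [this work] -/
theorem frontier_36_of_clusterBHK3
    (hG' : ∀ (S T : Set (Fin n)) (A B : Set (BondConfig (Fin n))),
      (∀ ⦃ω ω' : BondConfig (Fin n)⦄, (⋃ s ∈ S, openEdgeCluster ω s) ⊆ (⋃ s ∈ S, openEdgeCluster ω' s) → ω ∈ A → ω' ∈ A) →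
      (∀ ⦃ω ω' : BondConfig (Fin n)⦄, (⋃ t ∈ T, openEdgeCluster ω t) ⊆ (⋃ t ∈ T, openEdgeCluster ω' t) → ω ∈ B → ω' ∈ B) →
      0 ≤ sahiE3 (prodBernoulli w) {ω : BondConfig (Fin n) | ∀ s ∈ S, ∀ t ∈ T, ¬ (openGraph ω).Reachable s t} Aᶜ Bᶜ)
    (a b c y : Fin n) :
    0 ≤ sahiE3 (prodBernoulli w) (connEvent (row 36 n (a, b, c, y)).1) (connEvent (row 36 n (a, b, c, y)).2.1)
      (connEvent (row 36 n (a, b, c, y)).2.2) := by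
  have hr : row 36 n (a, b, c, y) = (sep [a] [b], sep [a] [c], sep [b] [y]) := rfl
  rw [hr]
  dsimp only
  rw [connEvent_sep_eq_D [a] [b], connEvent_sep_one_one a c, connEvent_sep_one_one b y]
  refine hG' {v | v ∈ [a]} {v | v ∈ [b]} (openConn a c) (openConn b y) ?_ ?_
  · intro ω ω' hs hω
    exact clusterMono_openConn_of_mem {v | v ∈ [a]} (by simp) c hs hω
  · intro ω ω' ht hω
    exact clusterMono_openConn_of_mem {v | v ∈ [b]} (by simp) y ht hω

/-- **Row 44 `(D[ab|cy], {a↮b}, {c↮y})` from the cluster-monotone third-order BHK inequality `G`** (`S = {a,b}`, `T = {c,y}`, internal literals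
`A = {a ~ b}`, `B = {c ~ y}`).  With `…LiteralDropping` this also yields rows 12, 27, 30. [this work] -/
theorem frontier_44_of_clusterBHK3
    (hG' : ∀ (S T : Set (Fin n)) (A B : Set (BondConfig (Fin n))),
      (∀ ⦃ω ω' : BondConfig (Fin n)⦄, (⋃ s ∈ S, openEdgeCluster ω s) ⊆ (⋃ s ∈ S, openEdgeCluster ω' s) → ω ∈ A → ω' ∈ A) →
      (∀ ⦃ω ω' : BondConfig (Fin n)⦄, (⋃ t ∈ T, openEdgeCluster ω t) ⊆ (⋃ t ∈ T, openEdgeCluster ω' t) → ω ∈ B → ω' ∈ B) →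
      0 ≤ sahiE3 (prodBernoulli w) {ω : BondConfig (Fin n) | ∀ s ∈ S, ∀ t ∈ T, ¬ (openGraph ω).Reachable s t} Aᶜ Bᶜ)
    (a b c y : Fin n) :
    0 ≤ sahiE3 (prodBernoulli w) (connEvent (row 44 n (a, b, c, y)).1) (connEvent (row 44 n (a, b, c, y)).2.1)
      (connEvent (row 44 n (a, b, c, y)).2.2) := by
  have hr : row 44 n (a, b, c, y) = (sep [a, b] [c, y], sep [a] [b], sep [c] [y]) := rfl
  rw [hr]
  dsimp only
  rw [connEvent_sep_eq_D [a, b] [c, y], connEvent_sep_one_one a b, connEvent_sep_one_one c y]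
  refine hG' {v | v ∈ [a, b]} {v | v ∈ [c, y]} (openConn a b) (openConn c y) ?_ ?_
  · intro ω ω' hs hω
    exact clusterMono_openConn_of_mem {v | v ∈ [a, b]} (by simp) b hs hω
  · intro ω ω' ht hω
    exact clusterMono_openConn_of_mem {v | v ∈ [c, y]} (by simp) y ht hω

/-- **Row 15 `(D[ab|c], D[ac|y], D[b|y])` from the cluster-monotone third-order BHK inequality `G`** (`S = {y}`, `T = {a,c}`, `A = {y ~ b}`,
`B = {c ~ a} ∪ {c ~ b}`; middle `D[ac|y]`). [this work] -/
theorem frontier_15_of_clusterBHK3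
    (hG' : ∀ (S T : Set (Fin n)) (A B : Set (BondConfig (Fin n))),
      (∀ ⦃ω ω' : BondConfig (Fin n)⦄, (⋃ s ∈ S, openEdgeCluster ω s) ⊆ (⋃ s ∈ S, openEdgeCluster ω' s) → ω ∈ A → ω' ∈ A) →
      (∀ ⦃ω ω' : BondConfig (Fin n)⦄, (⋃ t ∈ T, openEdgeCluster ω t) ⊆ (⋃ t ∈ T, openEdgeCluster ω' t) → ω ∈ B → ω' ∈ B) →
      0 ≤ sahiE3 (prodBernoulli w) {ω : BondConfig (Fin n) | ∀ s ∈ S, ∀ t ∈ T, ¬ (openGraph ω).Reachable s t} Aᶜ Bᶜ)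
    (a b c y : Fin n) :
    0 ≤ sahiE3 (prodBernoulli w) (connEvent (row 15 n (a, b, c, y)).1) (connEvent (row 15 n (a, b, c, y)).2.1)
      (connEvent (row 15 n (a, b, c, y)).2.2) := by
  have hr : row 15 n (a, b, c, y) = (sep [a, b] [c], sep [a, c] [y], sep [b] [y]) := rfl
  rw [hr]
  dsimp only
  rw [sahiE3_comm₁₂ (prodBernoulli w) (connEvent (sep [a, b] [c])), sahiE3_comm₂₃ (prodBernoulli w) (connEvent (sep [a, c] [y]))]
  rw [connEvent_sep_comm [a, c] [y], connEvent_sep_eq_D [y] [a, c], connEvent_sep_one_one b y, connEvent_sep_pair_single a b c]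
  have hby : (openConn b y : Set (BondConfig (Fin n)))ᶜ = (openConn y b)ᶜ := by
    ext ω; simp only [Set.mem_compl_iff]; rw [mem_openConn_comm]
  rw [hby]
  refine hG' {v | v ∈ [y]} {v | v ∈ [a, c]} (openConn y b) (openConn c a ∪ openConn c b) ?_ ?_
  · intro ω ω' hs hω
    exact clusterMono_openConn_of_mem {v | v ∈ [y]} (by simp) b hs hω
  · intro ω ω' ht hω
    rcases hω with h | h
    · exact Or.inl (clusterMono_openConn_of_mem {v | v ∈ [a, c]} (by simp) a ht h)
    · exact Or.inr (clusterMono_openConn_of_mem {v | v ∈ [a, c]} (by simp) b ht h)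

/-- **All three at once**: under the cluster-monotone inequality `G`, rows 15, 36 and 44 hold for every `n`-vertex weighted graph and all
terminals, hence (with `frontier_12_27_30_all_of_frontier_44_all`) six of the seven open four-point dec orbits. [this work] -/
theorem frontier_15_36_44_of_clusterBHK3
    (hG' : ∀ (S T : Set (Fin n)) (A B : Set (BondConfig (Fin n))),
      (∀ ⦃ω ω' : BondConfig (Fin n)⦄, (⋃ s ∈ S, openEdgeCluster ω s) ⊆ (⋃ s ∈ S, openEdgeCluster ω' s) → ω ∈ A → ω' ∈ A) →
      (∀ ⦃ω ω' : BondConfig (Fin n)⦄, (⋃ t ∈ T, openEdgeCluster ω t) ⊆ (⋃ t ∈ T, openEdgeCluster ω' t) → ω ∈ B → ω' ∈ B) →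
      0 ≤ sahiE3 (prodBernoulli w) {ω : BondConfig (Fin n) | ∀ s ∈ S, ∀ t ∈ T, ¬ (openGraph ω).Reachable s t} Aᶜ Bᶜ)
    (a b c y : Fin n) :
    0 ≤ sahiE3 (prodBernoulli w) (connEvent (row 15 n (a, b, c, y)).1) (connEvent (row 15 n (a, b, c, y)).2.1)
        (connEvent (row 15 n (a, b, c, y)).2.2) ∧
      0 ≤ sahiE3 (prodBernoulli w) (connEvent (row 36 n (a, b, c, y)).1) (connEvent (row 36 n (a, b, c, y)).2.1)
        (connEvent (row 36 n (a, b, c, y)).2.2) ∧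
      0 ≤ sahiE3 (prodBernoulli w) (connEvent (row 44 n (a, b, c, y)).1) (connEvent (row 44 n (a, b, c, y)).2.1)
        (connEvent (row 44 n (a, b, c, y)).2.2) :=
  ⟨frontier_15_of_clusterBHK3 w hG' a b c y, frontier_36_of_clusterBHK3 w hG' a b c y, frontier_44_of_clusterBHK3 w hG' a b c y⟩

end Summit.CriticalPhenomena.PercolationContinuityZ3.Theorems.FrontierDecRows
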